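import Literature.NumberTheory.EllipticCurves.FineSelmerDevissageProofs
import HarnessLib

/-!
# EQUIVARIANT dévissage for the fine Selmer group of a finite module over the cyclotomic tower:
# `Sel₀(K_∞, M)` is finite as soon as the `Gal(K̄/K_∞)`-EQUIVARIANT everywhere-unramified homomorphisms on
# `Gal(K̄/L·K_∞)` with values in `M/M′` and in `M′` are finite (proved; no definition, no named fact, no `sorry`)

`Proofs` file (theorems only) in topic `NumberTheory/EllipticCurves` (namespace
`Literature.NumberTheory.EllipticCurves.FineSelmerDevissage`, continued), written by the prover seat
`bsd-potss-rkm` g38 (cell `bsd-potss`; item stmt-BirchSwinnertonDyer-19196 `ReducibleKatoMember`,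
`--supports`; closes nothing; neither Conjecture A nor BSD is proved for any curve here).

## Why (the ISOTYPIC reading of Coates–Sujatha 2005 Cor. 3.6 / Wuthrich 2014 Lemma 14)

The sibling `FineSelmerDevissageProofs` (g33) reads `Sel₀(K_∞, M)` for a finite `Γ_K`-module `M` with a
`Γ_K`-equivariant `π : M → Q`, on `U = Gal(K̄/L·K_∞)` (`N = Gal(K̄/L)` open normal acting trivially on `Q`
and on `ker π`), through (i) the `Q`-shadow `π ∘ z|_U` of a fine cocycle `z`, (ii) finitely many values,
(iii) finitely many local profiles; its finiteness inputs are ALL everywhere-unramified continuous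
homomorphisms `U → Q` and the `ker π`-valued ones `U → M`.  For the reducible rows of an elliptic curve
(`L` the Borel field `K(χ₁, χ₂)`) that input is Iwasawa's `μ = 0` for the FULL class group of `L`.  But a
fine cocycle `z` is a cocycle on `H = Gal(K̄/K_∞) ⊇ U`, and the cocycle identity makes its shadow
`Gal(K̄/K_∞)`-EQUIVARIANT: `π z(h u h⁻¹) = h • π z(u)` (`h ∈ H`, `u ∈ U`; as in the tree's
`FineSelmerTrivialisingRestriction.restrict_equivariant_of_cocycle`, composed with `π`).  Likewise two fine
cocycles with the same record (i)–(iii) differ by `d = z₁ − z₂` with `d(H) ⊆ ker π` (record (ii) and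
`d(U) ⊆ ker π`), whence `d(h u h⁻¹) = h • d(u)` on `U`.  So only the EQUIVARIANT unramified homomorphisms
— the `χ₂`- resp. `χ₁`-ISOTYPIC parts of the unramified Iwasawa module of `L_∞` — have to be finite: this
is the input the cell's equivariant class-field-theoretic count
(`IwasawaTheory.EquivariantUnramifiedHomsZpTowerFinite.equivariantUnramifiedHoms_finite_of_card_le`, seat
conjA-anchor g19) produces from BOUNDED EQUIVARIANT class-group counts, i.e. from `μ = 0` of ONE cyclic
field per character instead of the whole Borel field.

## Main statement

`finite_fineSelmerInfty_of_extension_equivariant`: same setting as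
`finite_fineSelmerInfty_of_extension` (`K` a number field, `κ` CYCLOTOMIC, `M` finite discrete, `π : M → Q`
equivariant, `N` open normal acting trivially on `Q` and `ker π`, `S` finite with `I_𝔓` trivial on `M`
off `S`); IF the members `f` of `Hom(N ∩ H, Q; ∅)` with `f(h u h⁻¹) = h • f(u)` (`h ∈ H`) are finite and
the `ker π`-valued members of `Hom(N ∩ H, M; ∅)` with the same equivariance are finite, THEN
`Sel₀(K_∞, M)` is finite.  The equivariance condition is spelled exactly as in
`equivariantUnramifiedHoms_finite_of_card_le` (`∀ h ∈ ker κ, ∀ u u', ↑u' = h * ↑u * h⁻¹ → f u' = h • f u`).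
Proof = the sibling's proof (§1–§2 lemmas imported from it) with the two equivariance verifications added.

References: [CoatesSujatha2005] §3 (Thm. 3.4, Lemma 3.8, Cor. 3.6 and their proofs); [Wuthrich2014] Lemma 14;
[Lim2017FineSelmer] §3 (isotypic reading); [SerreGaloisCohomology1997] I.§5.8; [GreenbergLNM1716] §1, §3.
-/

set_option autoImplicit false

noncomputable section

open scoped Classical Pointwise

namespace Literature.NumberTheory.EllipticCurves.FineSelmerDevissage

open NumberField IsDedekindDomain Field
open Literature.NumberTheory.EllipticCurves Literature.NumberTheory.EllipticCurves.GreenbergSelmer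
  Literature.NumberTheory.EllipticCurves.FineSelmerTrivialisingRestriction
  Literature.NumberTheory.EllipticCurves.FineSelmerCoefficientMap
  Literature.NumberTheory.EllipticCurves.Greenberg1999
  Literature.NumberTheory.GaloisRepresentations

variable {K : Type} [Field K] [NumberField K] {p : ℕ} [Fact p.Prime]

section Main

variable (κ : ZpExtension K p)
variable {M : Type} [AddCommGroup M] [DistribMulAction (absoluteGaloisGroup K) M]
  [TopologicalSpace M] [DiscreteTopology M]
variable {Q : Type} [AddCommGroup Q] [DistribMulAction (absoluteGaloisGroup K) Q]
  [TopologicalSpace Q]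

/-- **Equivariant dévissage for `Sel₀(K_∞, M)` along `0 → ker π → M → Q`.** `K` a number field, `κ` its
CYCLOTOMIC `ℤ_p`-extension (`H = Gal(K̄/K_∞)`), `M` a finite discrete `Γ_K`-module, `π : M → Q` a
`Γ_K`-equivariant additive map to a discrete `Γ_K`-module, `N ≤ Γ_K` OPEN NORMAL acting trivially on `Q`
and on `ker π`, `S` a finite set of finite places off which the inertia groups act trivially on `M`.  If the
`H`-EQUIVARIANT everywhere-unramified continuous homomorphisms `f : N ∩ H → Q` (`f(h u h⁻¹) = h • f(u)`,
`h ∈ H`) are finite, and the `H`-equivariant `ker π`-valued members of `Hom(N ∩ H, M; ∅)` are finite, then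
`Sel₀(K_∞, M)` is finite.  Proof: as in `finite_fineSelmerInfty_of_extension` — a fine cocycle `z` on `H` is
recorded by (i) its `Q`-shadow `π ∘ z|_{N ∩ H}`, (ii) its values on representatives of `H/(N ∩ H)`,
(iii) its local profiles at `S` — plus: (i′) the shadow is `H`-equivariant by the cocycle identity
(`z(huh⁻¹) = z(h) + h•z(u) + hu•z(h⁻¹)`, `u` trivial on `Q`, `z(h) + h•z(h⁻¹) = z(1) = 0`), and (iv′) the
difference `d` of two fine cocycles with the same record has `d(H) ⊆ ker π` (by (i), (ii) and
`π(σ•m) = σ•π(m)`), so `hu • d(h⁻¹) = h • d(h⁻¹)` and `d(huh⁻¹) = h • d(u)`.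
[cite: CoatesSujatha2005, §3 (proofs of Thm. 3.4, Lemma 3.8 and Cor. 3.6)] [cite: Wuthrich2014, Lemma 14]
[cite: Lim2017FineSelmer, §3 (isotypic reading of Thm. 3.4)] [cite: SerreGaloisCohomology1997, I.§5.8 (inflation–restriction)] -/
theorem finite_fineSelmerInfty_of_extension_equivariant [Finite M] (hκ : κ.IsCyclotomic)
    (π : M →+ Q) (hπ : ∀ (σ : absoluteGaloisGroup K) (m : M), π (σ • m) = σ • π m)
    (N : Subgroup (absoluteGaloisGroup K)) [N.Normal]
    (hNopen : IsOpen (N : Set (absoluteGaloisGroup K)))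
    (hNQ : ∀ σ ∈ N, ∀ q : Q, σ • q = q) (hNC : ∀ σ ∈ N, ∀ m : M, π m = 0 → σ • m = m)
    (S : Set (HeightOneSpectrum (𝓞 K))) (hS : S.Finite)
    (hunr : ∀ v ∉ S, ∀ 𝔓 ∈ v.primesAbove, ∀ σ ∈ 𝔓.inertia (absoluteGaloisGroup K),
      ∀ m : M, σ • m = m)
    (hQfin : {f ∈ unramifiedHoms (N ⊓ κ.kerSubgroup) Q (∅ : Set (HeightOneSpectrum (𝓞 K))) |
      ∀ h ∈ κ.kerSubgroup, ∀ u u' : ↥(N ⊓ κ.kerSubgroup),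
        (u' : absoluteGaloisGroup K) = h * u * h⁻¹ → f u' = h • f u}.Finite)
    (hCfin : {f ∈ unramifiedHoms (N ⊓ κ.kerSubgroup) M (∅ : Set (HeightOneSpectrum (𝓞 K))) |
      (∀ u, π (f u) = 0) ∧ ∀ h ∈ κ.kerSubgroup, ∀ u u' : ↥(N ⊓ κ.kerSubgroup),
        (u' : absoluteGaloisGroup K) = h * u * h⁻¹ → f u' = h • f u}.Finite) :
    (fineSelmerInfty M κ : Set (subgroupH1 κ.kerSubgroup M)).Finite := by
  have hp : p.Prime := Fact.out
  set H := κ.kerSubgroup with hHdef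
  set U : Subgroup (absoluteGaloisGroup K) := N ⊓ H with hUdef
  have hUH : U ≤ H := inf_le_right
  have hUN : U ≤ N := inf_le_left
  set V : Subgroup H := U.subgroupOf H with hVdef
  -- `V` is open in the compact group `H`, so `H/V` is finite
  haveI : CompactSpace H := isCompact_iff_compactSpace.mp κ.isClosed_kerSubgroup.isCompact
  have hVopen : IsOpen (V : Set H) := by
    have : (V : Set H) = Subtype.val ⁻¹' (N : Set (absoluteGaloisGroup K)) := by
      ext x
      simp only [hVdef, hUdef, SetLike.mem_coe, Subgroup.mem_subgroupOf, Subgroup.mem_inf,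
        Set.mem_preimage]
      exact ⟨fun h ↦ h.1, fun h ↦ ⟨h, x.2⟩⟩
    rw [this]
    exact hNopen.preimage continuous_subtype_val
  haveI hfinHV : Finite (H ⧸ V) := Subgroup.quotient_finite_of_isOpen V hVopen
  -- `U` is normal in `Γ_K`
  have hUconj : ∀ (g : absoluteGaloisGroup K) {u : absoluteGaloisGroup K}, u ∈ U →
      g * u * g⁻¹ ∈ U := fun g u hu ↦
    Subgroup.mem_inf.2 ⟨(inferInstance : N.Normal).conj_mem _ (Subgroup.mem_inf.1 hu).1 g,
      (inferInstance : H.Normal).conj_mem _ (Subgroup.mem_inf.1 hu).2 g⟩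
  -- representatives: `c`, `τ`
  have hreps := fun v : HeightOneSpectrum (𝓞 K) ↦ exists_decomp_mul_rep_mul_mem_kerSubgroup κ hκ v
  choose cv hcv using hreps
  let c : ℕ := hS.toFinset.sup cv
  have hτex : ∀ i : ℕ, ∃ τ : absoluteGaloisGroup K, κ τ = Multiplicative.ofAdd ((i : ℕ) : ℤ_[p]) :=
    fun i ↦ κ.surjective _
  choose τ hτ using hτex
  -- the conjugating elements `g(i, q) = τ i · (q.out)⁻¹`
  let gι : ℕ → (H ⧸ V) → absoluteGaloisGroup K :=
    fun i q ↦ τ i * ((q.out : H) : absoluteGaloisGroup K)⁻¹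
  have hconjH : ∀ (g : absoluteGaloisGroup K) (x : H), g⁻¹ * (x : absoluteGaloisGroup K) * g ∈ H :=
    fun g x ↦ by simpa only [inv_inv] using (inferInstance : H.Normal).conj_mem _ x.2 g⁻¹
  -- the index type of local profiles
  let Idx : Type := ↥hS.toFinset × Fin (p ^ c) × (H ⧸ V)
  -- the records
  let Λ : contOneCocycles (discreteTopRep H M) → (U → M) := fun z u ↦ z.1 ⟨u, hUH u.2⟩
  let πΛ : contOneCocycles (discreteTopRep H M) → (U → Q) := fun z u ↦ π (z.1 ⟨u, hUH u.2⟩)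
  let qv : contOneCocycles (discreteTopRep H M) → ((H ⧸ V) → M) := fun z q ↦ z.1 q.out
  let P : contOneCocycles (discreteTopRep H M) → Idx → H → M := fun z idx x ↦
    if (x : absoluteGaloisGroup K) ∈ decomp (idx.1 : HeightOneSpectrum (𝓞 K)) then
      gι idx.2.1 idx.2.2 • z.1 ⟨(gι idx.2.1 idx.2.2)⁻¹ * x * gι idx.2.1 idx.2.2,
        hconjH (gι idx.2.1 idx.2.2) x⟩
    else 0
  let cob : Idx → M → H → M := fun idx a x ↦
    if (x : absoluteGaloisGroup K) ∈ decomp (idx.1 : HeightOneSpectrum (𝓞 K)) then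
      (x : absoluteGaloisGroup K) • a - a else 0
  let Θ : contOneCocycles (discreteTopRep H M) → (U → Q) × ((H ⧸ V) → M) × (Idx → H → M) :=
    fun z ↦ (πΛ z, qv z, P z)
  set Z0 : Set (contOneCocycles (discreteTopRep H M)) :=
    {z | oneCocycleClass _ z ∈ fineSelmerInfty M κ} with hZ0
  -- the cocycle identity, with the ambient action displayed
  have hcoc : ∀ (z : contOneCocycles (discreteTopRep H M)) (a b : H),
      z.1 (a * b) = z.1 a + (a : absoluteGaloisGroup K) • z.1 b := fun z a b ↦ z.2 a b
  have hcoc1 : ∀ z : contOneCocycles (discreteTopRep H M), z.1 1 = 0 := fun z ↦ by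
    have h := hcoc z 1 1
    rw [mul_one, Subgroup.coe_one, one_smul, left_eq_add] at h
    exact h
  -- `z(h) + h • z(h⁻¹) = z(1) = 0`
  have hcocinv : ∀ (z : contOneCocycles (discreteTopRep H M)) (h : absoluteGaloisGroup K) (hh : h ∈ H),
      z.1 ⟨h, hh⟩ + h • z.1 (⟨h, hh⟩ : H)⁻¹ = 0 := fun z h hh ↦ by
    have h1 := hcoc z ⟨h, hh⟩ (⟨h, hh⟩ : H)⁻¹
    rw [mul_inv_cancel, hcoc1] at h1
    exact h1.symm
  -- conjugation: `z(h u h⁻¹) = z(h) + h • z(u) + (h u) • z(h⁻¹)` for `h ∈ H`, `u ∈ U`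
  have hconjU : ∀ (h : absoluteGaloisGroup K) (hh : h ∈ H) (u u' : U),
      (u' : absoluteGaloisGroup K) = h * u * h⁻¹ →
        (⟨(u' : absoluteGaloisGroup K), hUH u'.2⟩ : H) =
          ⟨h, hh⟩ * ⟨(u : absoluteGaloisGroup K), hUH u.2⟩ * (⟨h, hh⟩ : H)⁻¹ := fun h hh u u' hu' ↦
    Subtype.ext (by simp only [Subgroup.coe_mul, Subgroup.coe_inv]; exact hu')
  have hcocconj : ∀ (z : contOneCocycles (discreteTopRep H M)) (h : absoluteGaloisGroup K) (hh : h ∈ H)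
      (u u' : U), (u' : absoluteGaloisGroup K) = h * u * h⁻¹ →
        z.1 ⟨(u' : absoluteGaloisGroup K), hUH u'.2⟩ =
          z.1 ⟨h, hh⟩ + h • z.1 ⟨(u : absoluteGaloisGroup K), hUH u.2⟩ +
            (h * (u : absoluteGaloisGroup K)) • z.1 (⟨h, hh⟩ : H)⁻¹ := by
    intro z h hh u u' hu'
    rw [hconjU h hh u u' hu', hcoc, hcoc]
    rfl
  ------------------------------------------------------------------
  -- (F1') the `Q`-shadow is `H`-EQUIVARIANT (cocycle identity; `U` acts trivially on `Q`)
  have hF1eq : ∀ z : contOneCocycles (discreteTopRep H M), ∀ h ∈ H, ∀ u u' : U,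
      (u' : absoluteGaloisGroup K) = h * u * h⁻¹ → πΛ z u' = h • πΛ z u := by
    intro z h hh u u' hu'
    have e1 := hcocconj z h hh u u' hu'
    have e2 := hcocinv z h hh
    show π (z.1 ⟨(u' : absoluteGaloisGroup K), hUH u'.2⟩) =
      h • π (z.1 ⟨(u : absoluteGaloisGroup K), hUH u.2⟩)
    rw [e1, map_add, map_add, hπ h, hπ (h * (u : absoluteGaloisGroup K)), mul_smul,
      hNQ (u : absoluteGaloisGroup K) (hUN u.2), ← hπ h (z.1 (⟨h, hh⟩ : H)⁻¹), add_right_comm,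
      ← map_add, e2, map_zero, zero_add]
  -- (F1) the `Q`-shadow is an everywhere-unramified homomorphism
  have hF1 : ∀ z ∈ Z0, πΛ z ∈ unramifiedHoms U Q (∅ : Set (HeightOneSpectrum (𝓞 K))) := by
    intro z hz
    refine ⟨?_, fun a b ↦ ?_, fun v _ 𝔓 h𝔓 u hu ↦ ?_⟩
    · exact (continuous_of_discreteTopology (f := π)).comp
        (z.1.continuous.comp (continuous_subtype_val.subtype_mk _))
    · have hab : (⟨((a * b : U) : absoluteGaloisGroup K), hUH (a * b).2⟩ : H) =
          ⟨(a : absoluteGaloisGroup K), hUH a.2⟩ * ⟨(b : absoluteGaloisGroup K), hUH b.2⟩ := rfl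
      show π (z.1 _) = π (z.1 _) + π (z.1 _)
      rw [hab, hcoc, map_add, hπ, hNQ _ (hUN a.2)]
    · haveI := HeightOneSpectrum.isMaximal_of_mem_primesAbove h𝔓
      obtain ⟨a, ha⟩ := exists_eq_smul_sub_of_mem_fineSelmerInfty κ z hz 𝔓
      have h := ha ⟨(u : absoluteGaloisGroup K), hUH u.2⟩
        (Ideal.inertia_le_decompositionSubgroup _ _ hu)
      show π (z.1 _) = 0
      rw [h, map_sub, hπ, hNQ _ (hUN u.2), sub_self]
  ------------------------------------------------------------------
  -- (F2) the local profiles are coboundaries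
  have hF2 : ∀ z ∈ Z0, P z ∈ Set.univ.pi fun idx ↦ Set.range (cob idx) := by
    intro z hz
    rw [Set.mem_univ_pi]
    rintro ⟨v, i, q⟩
    have hloc := ((mem_fineSelmerInfty_iff_resOfLe κ _).1 hz).1 (v : HeightOneSpectrum (𝓞 K))
      (gι i q)
    obtain ⟨a, ha⟩ := (CocycleCriteria.conjH1_oneCocycleClass_mem_ker_resOfLe_iff
      (inf_le_left : H ⊓ decomp (v : HeightOneSpectrum (𝓞 K)) ≤ H) (gι i q) z).1 hloc
    refine ⟨a, funext fun x ↦ ?_⟩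
    by_cases hx : (x : absoluteGaloisGroup K) ∈ decomp (v : HeightOneSpectrum (𝓞 K))
    · have h := ha ⟨x, Subgroup.mem_inf.2 ⟨x.2, hx⟩⟩
      simp only [cob, P, hx, if_true]
      exact h.symm
    · simp only [cob, P, hx, if_false]
  ------------------------------------------------------------------
  -- (F3) two fine cocycles with the same record differ on `U` by a `ker π`-valued, `H`-EQUIVARIANT,
  -- unramified hom
  have hF3 : ∀ z₁ ∈ Z0, ∀ z₂ ∈ Z0, Θ z₁ = Θ z₂ →
      (fun u ↦ Λ z₁ u - Λ z₂ u) ∈ {f ∈ unramifiedHoms U M (∅ : Set (HeightOneSpectrum (𝓞 K))) |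
        (∀ u, π (f u) = 0) ∧ ∀ h ∈ H, ∀ u u' : U,
          (u' : absoluteGaloisGroup K) = h * u * h⁻¹ → f u' = h • f u} := by
    intro z₁ hz₁ z₂ hz₂ hΘ
    obtain ⟨hΘ1, hΘ23⟩ := Prod.ext_iff.1 hΘ
    obtain ⟨hΘ2, hΘ3⟩ := Prod.ext_iff.1 hΘ23
    set f : U → M := fun u ↦ Λ z₁ u - Λ z₂ u with hfdef
    -- values in `ker π`
    have hfπ : ∀ u, π (f u) = 0 := fun u ↦ by
      have h := congrFun hΘ1 u
      show π (z₁.1 _ - z₂.1 _) = 0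
      rw [map_sub, sub_eq_zero]
      exact h
    -- the difference takes values in `ker π` on ALL of `H` (records (i) and (ii))
    have hdH : ∀ x : H, π (z₁.1 x - z₂.1 x) = 0 := by
      intro x
      obtain ⟨w, hw⟩ := QuotientGroup.mk_out_eq_mul V x
      have hx : x = (QuotientGroup.mk x : H ⧸ V).out * ((w⁻¹ : V) : H) := by
        rw [hw, Subgroup.coe_inv, mul_inv_cancel_right]
      have hwU : (((w⁻¹ : V) : H) : absoluteGaloisGroup K) ∈ U := Subgroup.mem_subgroupOf.1 (w⁻¹).2
      have h2 : z₁.1 (QuotientGroup.mk x : H ⧸ V).out = z₂.1 (QuotientGroup.mk x : H ⧸ V).out :=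
        congrFun hΘ2 _
      have h3 : π (z₁.1 ((w⁻¹ : V) : H) - z₂.1 ((w⁻¹ : V) : H)) = 0 :=
        hfπ ⟨(((w⁻¹ : V) : H) : absoluteGaloisGroup K), hwU⟩
      rw [hx, hcoc, hcoc, h2, add_sub_add_left_eq_sub, ← smul_sub, hπ, h3, smul_zero]
    -- `H`-equivariance
    have hfeq : ∀ h ∈ H, ∀ u u' : U,
        (u' : absoluteGaloisGroup K) = h * u * h⁻¹ → f u' = h • f u := by
      intro h hh u u' hu'
      have e1 := hcocconj z₁ h hh u u' hu'
      have e2 := hcocconj z₂ h hh u u' hu'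
      have i1 := hcocinv z₁ h hh
      have i2 := hcocinv z₂ h hh
      -- `u` acts trivially on `z₁(h⁻¹) - z₂(h⁻¹) ∈ ker π`
      have hk : (h * (u : absoluteGaloisGroup K)) • z₁.1 (⟨h, hh⟩ : H)⁻¹ -
          (h * (u : absoluteGaloisGroup K)) • z₂.1 (⟨h, hh⟩ : H)⁻¹ =
            h • z₁.1 (⟨h, hh⟩ : H)⁻¹ - h • z₂.1 (⟨h, hh⟩ : H)⁻¹ := by
        rw [← smul_sub, ← smul_sub, mul_smul, hNC (u : absoluteGaloisGroup K) (hUN u.2) _ (hdH _)]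
      have hk2 : z₁.1 ⟨h, hh⟩ - z₂.1 ⟨h, hh⟩ +
          (h • z₁.1 (⟨h, hh⟩ : H)⁻¹ - h • z₂.1 (⟨h, hh⟩ : H)⁻¹) = 0 := by
        calc z₁.1 ⟨h, hh⟩ - z₂.1 ⟨h, hh⟩ + (h • z₁.1 (⟨h, hh⟩ : H)⁻¹ - h • z₂.1 (⟨h, hh⟩ : H)⁻¹)
            = (z₁.1 ⟨h, hh⟩ + h • z₁.1 (⟨h, hh⟩ : H)⁻¹) -
                (z₂.1 ⟨h, hh⟩ + h • z₂.1 (⟨h, hh⟩ : H)⁻¹) := by abel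
          _ = 0 := by rw [i1, i2, sub_zero]
      show z₁.1 ⟨(u' : absoluteGaloisGroup K), hUH u'.2⟩ - z₂.1 ⟨(u' : absoluteGaloisGroup K), hUH u'.2⟩ =
        h • (z₁.1 ⟨(u : absoluteGaloisGroup K), hUH u.2⟩ - z₂.1 ⟨(u : absoluteGaloisGroup K), hUH u.2⟩)
      rw [e1, e2]
      calc z₁.1 ⟨h, hh⟩ + h • z₁.1 ⟨(u : absoluteGaloisGroup K), hUH u.2⟩ +
              (h * (u : absoluteGaloisGroup K)) • z₁.1 (⟨h, hh⟩ : H)⁻¹ -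
            (z₂.1 ⟨h, hh⟩ + h • z₂.1 ⟨(u : absoluteGaloisGroup K), hUH u.2⟩ +
              (h * (u : absoluteGaloisGroup K)) • z₂.1 (⟨h, hh⟩ : H)⁻¹)
          = (h • z₁.1 ⟨(u : absoluteGaloisGroup K), hUH u.2⟩ -
              h • z₂.1 ⟨(u : absoluteGaloisGroup K), hUH u.2⟩) +
              ((z₁.1 ⟨h, hh⟩ - z₂.1 ⟨h, hh⟩) +
                ((h * (u : absoluteGaloisGroup K)) • z₁.1 (⟨h, hh⟩ : H)⁻¹ -
                  (h * (u : absoluteGaloisGroup K)) • z₂.1 (⟨h, hh⟩ : H)⁻¹)) := by abel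
        _ = h • (z₁.1 ⟨(u : absoluteGaloisGroup K), hUH u.2⟩ -
              z₂.1 ⟨(u : absoluteGaloisGroup K), hUH u.2⟩) := by
            rw [hk, hk2, add_zero, smul_sub]
    -- additivity
    have hfadd : ∀ a b : U, f (a * b) = f a + f b := by
      intro a b
      have hab : (⟨((a * b : U) : absoluteGaloisGroup K), hUH (a * b).2⟩ : H) =
          ⟨(a : absoluteGaloisGroup K), hUH a.2⟩ * ⟨(b : absoluteGaloisGroup K), hUH b.2⟩ := rfl
      have hfix : (a : absoluteGaloisGroup K) • f b = f b := hNC _ (hUN a.2) _ (hfπ b)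
      show z₁.1 _ - z₂.1 _ = (z₁.1 _ - z₂.1 _) + (z₁.1 _ - z₂.1 _)
      rw [hab, hcoc, hcoc]
      have hfix' : (a : absoluteGaloisGroup K) • (z₁.1 ⟨(b : absoluteGaloisGroup K), hUH b.2⟩ -
          z₂.1 ⟨(b : absoluteGaloisGroup K), hUH b.2⟩) =
          z₁.1 ⟨(b : absoluteGaloisGroup K), hUH b.2⟩ - z₂.1 ⟨(b : absoluteGaloisGroup K), hUH b.2⟩ :=
        hfix
      rw [smul_sub] at hfix'
      rw [← hfix']
      abel
    have hf1 : f 1 = 0 := by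
      have h := hfadd 1 1
      rw [mul_one, left_eq_add] at h
      exact h
    have hfinv : ∀ a : U, f a⁻¹ = -f a := fun a ↦ by
      have h := hfadd a a⁻¹
      rw [mul_inv_cancel, hf1] at h
      exact (neg_eq_of_add_eq_zero_right h.symm).symm
    have hfconj : ∀ a b : U, f (a⁻¹ * b * a) = f b := fun a b ↦ by
      rw [hfadd, hfadd, hfinv, neg_add_cancel_comm]
    -- continuity
    have hfcont : Continuous f :=
      (continuous_of_discreteTopology (f := fun x : M × M ↦ x.1 - x.2)).comp
        ((z₁.1.continuous.comp (continuous_subtype_val.subtype_mk _)).prodMk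
          (z₂.1.continuous.comp (continuous_subtype_val.subtype_mk _)))
    refine ⟨⟨hfcont, hfadd, fun v _ 𝔓 h𝔓 u hu ↦ ?_⟩, hfπ, hfeq⟩
    haveI := HeightOneSpectrum.isMaximal_of_mem_primesAbove h𝔓
    by_cases hvS : v ∈ S
    swap
    · -- unramified place: both cocycles vanish at `u`
      obtain ⟨a₁, ha₁⟩ := exists_eq_smul_sub_of_mem_fineSelmerInfty κ z₁ hz₁ 𝔓
      obtain ⟨a₂, ha₂⟩ := exists_eq_smul_sub_of_mem_fineSelmerInfty κ z₂ hz₂ 𝔓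
      have huD := Ideal.inertia_le_decompositionSubgroup _ _ hu
      show z₁.1 _ - z₂.1 _ = 0
      rw [ha₁ ⟨(u : absoluteGaloisGroup K), hUH u.2⟩ huD,
        ha₂ ⟨(u : absoluteGaloisGroup K), hUH u.2⟩ huD, hunr v hvS 𝔓 h𝔓 _ hu,
        hunr v hvS 𝔓 h𝔓 _ hu, sub_self, sub_self, sub_self]
    · -- ramified place: use the profile at the right representative
      obtain ⟨ρ, hρ⟩ := HeightOneSpectrum.exists_smul_eq_of_mem_primesAbove_holds
        (adicCompletionPrime_mem_primesAbove K v) h𝔓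
      obtain ⟨δ₁, hδ₁, i, hi, h, hh, hdec⟩ := hcv v τ hτ ρ⁻¹
      set q : H ⧸ V := QuotientGroup.mk ⟨h⁻¹, H.inv_mem hh⟩ with hqdef
      obtain ⟨w, hw⟩ := QuotientGroup.mk_out_eq_mul V (⟨h⁻¹, H.inv_mem hh⟩ : H)
      set r : absoluteGaloisGroup K := ((q.out : H) : absoluteGaloisGroup K) with hrdef
      have hwU : ((w : H) : absoluteGaloisGroup K) ∈ U := Subgroup.mem_subgroupOf.1 w.2
      have hvS' : v ∈ hS.toFinset := hS.mem_toFinset.2 hvS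
      have hic : i < p ^ c :=
        lt_of_lt_of_le hi (Nat.pow_le_pow_right hp.pos (Finset.le_sup (f := cv) hvS'))
      let idx : Idx := (⟨v, hvS'⟩, ⟨i, hic⟩, q)
      set g : absoluteGaloisGroup K := τ i * r⁻¹ with hgdef
      have hgι : gι i q = g := rfl
      -- `h⁻¹ = r · w⁻¹`
      have hr : h⁻¹ = r * ((w : H) : absoluteGaloisGroup K)⁻¹ := by
        have h1 := congrArg (fun x : H ↦ (x : absoluteGaloisGroup K)) hw
        simp only [Subgroup.coe_mul] at h1
        rw [hrdef, hqdef, h1, mul_inv_cancel_right]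
      set u₀ : absoluteGaloisGroup K := r * ((w : H) : absoluteGaloisGroup K)⁻¹ * r⁻¹ with hu₀def
      have hu₀ : u₀ ∈ U := hUconj r (U.inv_mem hwU)
      have hρ' : ρ = u₀ * g⁻¹ * δ₁⁻¹ := by
        have : ρ = h⁻¹ * (τ i)⁻¹ * δ₁⁻¹ := by rw [← inv_inv ρ, hdec]; group
        rw [this, hr, hu₀def, hgdef]
        group
      -- `ρ⁻¹ u ρ ∈ I_{𝔓₀(v)} ≤ D_v`, hence `g (u₀⁻¹ u u₀) g⁻¹ = δ₁⁻¹ (ρ⁻¹ u ρ) δ₁ ∈ D_v`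
      have hu' : (u : absoluteGaloisGroup K) ∈
          (ρ • adicCompletionPrime K v).inertia (absoluteGaloisGroup K) := by
        rw [hρ]; exact hu
      have hy0 : ρ⁻¹ * (u : absoluteGaloisGroup K) * ρ ∈
          (adicCompletionPrime K v).inertia (absoluteGaloisGroup K) :=
        conj_mem_inertia_of_mem_inertia_smul _ _ hu'
      have hy0D : ρ⁻¹ * (u : absoluteGaloisGroup K) * ρ ∈ decomp v := by
        have h1 := Ideal.inertia_le_decompositionSubgroup _ _ hy0
        rw [decompositionSubgroup_adicCompletionPrime_eq_range] at h1
        exact h1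
      set y : absoluteGaloisGroup K := u₀⁻¹ * (u : absoluteGaloisGroup K) * u₀ with hydef
      have hyU : y ∈ U := U.mul_mem (U.mul_mem (U.inv_mem hu₀) u.2) hu₀
      have hxeq : g * y * g⁻¹ = δ₁⁻¹ * (ρ⁻¹ * (u : absoluteGaloisGroup K) * ρ) * δ₁ := by
        rw [hydef, hρ']; group
      have hxD : g * y * g⁻¹ ∈ decomp v := by
        rw [hxeq]
        exact (decomp v).mul_mem ((decomp v).mul_mem ((decomp v).inv_mem hδ₁) hy0D) hδ₁
      have hxH : g * y * g⁻¹ ∈ H := (inferInstance : H.Normal).conj_mem _ (hUH hyU) g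
      -- evaluate the profile equality at `x = g y g⁻¹`
      have hP : P z₁ = P z₂ := hΘ3
      have hPeq : P z₁ idx ⟨g * y * g⁻¹, hxH⟩ = P z₂ idx ⟨g * y * g⁻¹, hxH⟩ := by
        rw [hP]
      have hxD' : ((⟨g * y * g⁻¹, hxH⟩ : H) : absoluteGaloisGroup K) ∈
          decomp ((idx.1 : HeightOneSpectrum (𝓞 K))) := hxD
      simp only [P, hxD', if_true] at hPeq
      have hPeq' : z₁.1 ⟨g⁻¹ * (g * y * g⁻¹) * g, hconjH g ⟨g * y * g⁻¹, hxH⟩⟩ =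
          z₂.1 ⟨g⁻¹ * (g * y * g⁻¹) * g, hconjH g ⟨g * y * g⁻¹, hxH⟩⟩ :=
        MulAction.injective g hPeq
      have hyy : (⟨g⁻¹ * (g * y * g⁻¹) * g, hconjH g ⟨g * y * g⁻¹, hxH⟩⟩ : H) = ⟨y, hUH hyU⟩ :=
        Subtype.ext (by simp only; group)
      rw [hyy] at hPeq'
      -- `f y = 0`, hence `f u = 0`
      have hfy : f ⟨y, hyU⟩ = 0 := by
        show z₁.1 _ - z₂.1 _ = 0
        rw [sub_eq_zero]
        exact hPeq'
      have huy : (u : U) = (⟨u₀, hu₀⟩ : U)⁻¹⁻¹ * ⟨y, hyU⟩ * (⟨u₀, hu₀⟩ : U)⁻¹ := by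
        apply Subtype.ext
        simp only [inv_inv, Subgroup.coe_mul, Subgroup.coe_inv, hydef]
        group
      rw [huy, hfconj, hfy]
  ------------------------------------------------------------------
  -- (F4) a cocycle is determined by its restriction to `U` and its values on representatives
  have hF4 : Function.Injective fun z : contOneCocycles (discreteTopRep H M) ↦ (Λ z, qv z) := by
    intro z z' hzz'
    simp only [Prod.mk.injEq] at hzz'
    obtain ⟨hΛ, hq⟩ := hzz'
    apply Subtype.ext
    ext x
    obtain ⟨w, hw⟩ := QuotientGroup.mk_out_eq_mul V x
    have hx : x = (QuotientGroup.mk x : H ⧸ V).out * ((w⁻¹ : V) : H) := by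
      rw [hw, Subgroup.coe_inv, mul_inv_cancel_right]
    have hwU : (((w⁻¹ : V) : H) : absoluteGaloisGroup K) ∈ U := Subgroup.mem_subgroupOf.1 (w⁻¹).2
    have h1 : z.1 ((w⁻¹ : V) : H) = z'.1 ((w⁻¹ : V) : H) :=
      congrFun hΛ ⟨(((w⁻¹ : V) : H) : absoluteGaloisGroup K), hwU⟩
    have h2 : z.1 (QuotientGroup.mk x : H ⧸ V).out = z'.1 (QuotientGroup.mk x : H ⧸ V).out :=
      congrFun hq _
    rw [hx, hcoc, hcoc, h2, h1]
  ------------------------------------------------------------------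
  -- (F5) assembly
  haveI : Finite Idx := inferInstance
  set EQ : Set (U → Q) := {f ∈ unramifiedHoms U Q (∅ : Set (HeightOneSpectrum (𝓞 K))) |
      ∀ h ∈ H, ∀ u u' : U, (u' : absoluteGaloisGroup K) = h * u * h⁻¹ → f u' = h • f u} with hEQ
  have hTfin : (EQ ×ˢ
      ((Set.univ : Set ((H ⧸ V) → M)) ×ˢ Set.univ.pi fun idx ↦ Set.range (cob idx))).Finite :=
    hQfin.prod (Set.finite_univ.prod (Set.Finite.pi fun idx ↦ Set.finite_range (cob idx)))
  have hΘsub : Θ '' Z0 ⊆ EQ ×ˢ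
      ((Set.univ : Set ((H ⧸ V) → M)) ×ˢ Set.univ.pi fun idx ↦ Set.range (cob idx)) := by
    rintro _ ⟨z, hz, rfl⟩
    exact ⟨⟨hF1 z hz, fun h hh u u' hu' ↦ hF1eq z h hh u u' hu'⟩, Set.mem_univ _, hF2 z hz⟩
  have hΘfin : (Θ '' Z0).Finite := hTfin.subset hΘsub
  -- the image of `z ↦ (Θ z, Λ z)` on `Z0` is finite
  let F : contOneCocycles (discreteTopRep H M) → ((U → Q) × ((H ⧸ V) → M) × (Idx → H → M)) × (U → M) :=
    fun z ↦ (Θ z, Λ z)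
  have hFimg : (F '' Z0).Finite := by
    have hcover : F '' Z0 ⊆ ⋃ θ ∈ Θ '' Z0, F '' (Z0 ∩ {z | Θ z = θ}) := by
      rintro _ ⟨z, hz, rfl⟩
      exact Set.mem_biUnion ⟨z, hz, rfl⟩ ⟨z, ⟨hz, rfl⟩, rfl⟩
    refine (hΘfin.biUnion fun θ hθ ↦ ?_).subset hcover
    obtain ⟨z₀, hz₀, rfl⟩ := hθ
    have hsub : F '' (Z0 ∩ {z | Θ z = Θ z₀}) ⊆
        (fun f : U → M ↦ (Θ z₀, fun u ↦ Λ z₀ u + f u)) ''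
          {f ∈ unramifiedHoms U M (∅ : Set (HeightOneSpectrum (𝓞 K))) |
            (∀ u, π (f u) = 0) ∧ ∀ h ∈ H, ∀ u u' : U,
              (u' : absoluteGaloisGroup K) = h * u * h⁻¹ → f u' = h • f u} := by
      rintro _ ⟨z, ⟨hz, hzθ⟩, rfl⟩
      refine ⟨fun u ↦ Λ z u - Λ z₀ u, hF3 z hz z₀ hz₀ hzθ, ?_⟩
      show (Θ z₀, fun u ↦ Λ z₀ u + (Λ z u - Λ z₀ u)) = (Θ z, Λ z)
      rw [(hzθ : Θ z = Θ z₀)]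
      congr 1
      funext u
      abel
    exact (hCfin.image _).subset hsub
  have hZ0fin : Z0.Finite :=
    Set.Finite.of_finite_image hFimg fun z _ z' _ hzz' ↦ hF4 (by
      have hΛ : Λ z = Λ z' := congrArg Prod.snd hzz'
      have hq : qv z = qv z' := congrArg (fun t ↦ t.1.2.1) hzz'
      exact Prod.ext hΛ hq)
  -- every class is represented
  have hsub : (fineSelmerInfty M κ : Set (subgroupH1 H M)) ⊆
      oneCocycleClass (discreteTopRep H M) '' Z0 := by
    intro x hx
    obtain ⟨z, rfl⟩ := oneCocycleClass_surjective _ x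
    exact ⟨z, hx, rfl⟩
  exact (hZ0fin.image _).subset hsub

end Main

end Literature.NumberTheory.EllipticCurves.FineSelmerDevissage

end
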